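import Summits.BirchSwinnertonDyer.BirchSwinnertonDyer.Theorems.SignedLowerHalvesSmallImageLowerHalfBothSignsRttD2SeqJ3LayerPairingOf
import HarnessLib

/-!
# Route `SignedLowerHalves`, crux L `SmallImageLowerHalfBothSigns` (stmt-BirchSwinnertonDyer-23599), line `rtt_w3` v14 → v15 — E2, row J3
# (Galois side): THE `Good` SETS OF THE J3 ASSEMBLY — local torsion-level classes whose image in `H¹(K_{∞,v}, M)` lies in the saturated local condition `E^ε_{sat,v}` —
# with the three binders `hgoodE` (tautological), `hgood_mono`, `hgood` (exhaustion of `E^ε_{sat,v}` by layers and torsion levels) of `exists_junction_exact_of_layerPairing` (p784993)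

WIDTH seat `bsd-line-slh-p3-w3` g22 under LEAD `cruxlead-stmt-BirchSwinnertonDyer-23599` g11 (cell `bsd-ssimc`); helper `--supports stmt-BirchSwinnertonDyer-23599`.
ONE DEFINITION WITH BODY (`goodLevel`, a preimage) + THEOREMS; no named fact, no instance, no `sorry`. HONEST FRAMING: bookkeeping inputs of the J3 assembly for the inhabitant
`layerPairingOf` (p789748); the mathematical inputs `hrecL`/`hsolL` (finite-level Poitou–Tate) and the coefficient pairings remain. E2, crux L/M, BSD remain OPEN, proved for NO curve.

* `goodLevel … n k ⊆ H¹(U_{n,v}, M[p^k])` := preimage of `E^ε_{sat,v} ≤ H¹(U_∞, M)` under `res_{n→∞} ∘ (M[p^k] ⊆ M)_*`; `mem_goodLevel_iff`;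
  ★ `goodLevel_mono` (closed under `incl ∘ res`), ★ `exists_mem_goodLevel` (every class of `E^ε_{sat,v}` comes from some good `ℓ`: `exists_resOfLe_layer_eq` p783849 + `exists_torsToH1_eq` p785597);
  the same three in the binder shapes of p784993 for `𝓛 := layerPairingOf …`: `layerPairingOf_hgoodE`, `layerPairingOf_hgood_mono`, `layerPairingOf_hgood`.
References: [SerreGaloisCohomology1997] I §2.2 Prop. 8; [Rubin2000] §4.2, App. B.2; [Kobayashi2003] Thm. 7.3 i).
-/

set_option autoImplicit false
set_option linter.dupNamespace false -- D-0017: single-problem summit, the namespace repeats the problem name by design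
noncomputable section

open scoped Classical
open NumberField IsDedekindDomain Field CategoryTheory Function

namespace Summit.BirchSwinnertonDyer.BirchSwinnertonDyer.Theorems.SmallImageRttD2Seq

open Literature.NumberTheory.EllipticCurves Literature.NumberTheory.EllipticCurves.Kobayashi2003
  Literature.NumberTheory.EllipticCurves.GreenbergVatsal2000 Literature.NumberTheory.GaloisRepresentations Literature.NumberTheory.GaloisCohomology
  Literature.NumberTheory.ComplexMultiplication.EllipticUnits.JohnsonLeungKings2011
  Summit.BirchSwinnertonDyer.BirchSwinnertonDyer.Theorems.SmallImageCharSignedSelmer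
  Summit.BirchSwinnertonDyer.BirchSwinnertonDyer.Theorems.SmallImageRttD2J1

section Good

variable {K : Type} [Field K] [NumberField K] {p : ℕ} [Fact p.Prime] (S : Set (PadicAlgCl p)) (κ : ZpExtension K p) (v : HeightOneSpectrum (𝓞 K))
  (M : Type) [AddCommGroup M] [TopologicalSpace M] [DiscreteTopology M] [Module (padicCoeffIntegers S) M]
  [DistribMulAction (absoluteGaloisGroup (v.adicCompletion K)) M]
  (V : WeierstrassCurve K) (j : V.geomPrimaryTorsion p →+ M) (ε : ℤˣ)

/-- **The good local classes at level `(n,k)`**: `ℓ ∈ H¹(U_{n,v}, M[p^k])` whose image `res_{n→∞}((M[p^k] ⊆ M)_* ℓ) ∈ H¹(U_∞, M)` lies in the saturated local condition `E^ε_{sat,v}`.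
[cite: Kobayashi2003, Thm. 7.3 i)] [cite: Rubin2000, §4.2] -/
def goodLevel (n k : ℕ) : Set (subgroupH1 (localSubgroupOfEmb (κ.layerSubgroup n) (closureEmb (K := K) (v.adicCompletion K))) ↥(torsionPow M p k)) :=
  {ℓ | resOfLe M (localSubgroupOfEmb_kerSubgroup_le κ v n) (torsToH1 M p _ k ℓ) ∈ localCondInftySat κ M (padicCoeffIntegers S) V j ε v}

/-- Membership in `goodLevel`. [folklore] -/
theorem mem_goodLevel_iff (n k : ℕ) (ℓ : subgroupH1 (localSubgroupOfEmb (κ.layerSubgroup n) (closureEmb (K := K) (v.adicCompletion K))) ↥(torsionPow M p k)) :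
    ℓ ∈ goodLevel S κ v M V j ε n k ↔ resOfLe M (localSubgroupOfEmb_kerSubgroup_le κ v n) (torsToH1 M p _ k ℓ) ∈ localCondInftySat κ M (padicCoeffIntegers S) V j ε v :=
  Iff.rfl

/-- ★ **`Good` is closed under `incl ∘ res`** (the image in `H¹(U_∞, M)` is unchanged). [cite: NeukirchSchmidtWingberg2008, I §5] -/
theorem goodLevel_mono {n n' : ℕ} (hn : n ≤ n') {k k' : ℕ} (hk : k ≤ k')
    (ℓ : subgroupH1 (localSubgroupOfEmb (κ.layerSubgroup n) (closureEmb (K := K) (v.adicCompletion K))) ↥(torsionPow M p k)) (hℓ : ℓ ∈ goodLevel S κ v M V j ε n k) :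
    torsIncl M p _ hk (resOfLe ↥(torsionPow M p k) (localSubgroupOfEmb_layerSubgroup_antitone κ v hn) ℓ) ∈ goodLevel S κ v M V j ε n' k' := by
  rw [mem_goodLevel_iff, torsToH1_torsIncl, torsToH1_resOfLe, ← AddMonoidHom.comp_apply, resOfLe_comp_holds]
  exact hℓ

/-- ★ **Exhaustion of `E^ε_{sat,v}` by good classes**: every `c ∈ E^ε_{sat,v} ≤ H¹(U_∞, M)` is the image of some `ℓ ∈ Good_{n,k}` (`M` `p`-primary with open stabilisers: layers by
`exists_resOfLe_layer_eq`, torsion levels by `exists_torsToH1_eq`). [cite: SerreGaloisCohomology1997, I §2.2 Prop. 8] [cite: Rubin2000, App. B.2] -/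
theorem exists_mem_goodLevel (hstab : ∀ m : M, IsOpen (MulAction.stabilizer (absoluteGaloisGroup (v.adicCompletion K)) m : Set (absoluteGaloisGroup (v.adicCompletion K))))
    (hM : ∀ m : M, ∃ k : ℕ, p ^ k • m = 0) (c : localCondInftySat κ M (padicCoeffIntegers S) V j ε v) :
    ∃ (n k : ℕ) (ℓ : subgroupH1 (localSubgroupOfEmb (κ.layerSubgroup n) (closureEmb (K := K) (v.adicCompletion K))) ↥(torsionPow M p k)),
      ℓ ∈ goodLevel S κ v M V j ε n k ∧ resOfLe M (localSubgroupOfEmb_kerSubgroup_le κ v n) (torsToH1 M p _ k ℓ) = c := by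
  obtain ⟨n, c', hc'⟩ := exists_resOfLe_layer_eq hstab (c : subgroupH1 (localSubgroupOfEmb κ.kerSubgroup (closureEmb (K := K) (v.adicCompletion K))) M)
  haveI : CompactSpace (absoluteGaloisGroup (v.adicCompletion K)) := absoluteGaloisGroup_compactSpace _
  haveI : CompactSpace ↥(localSubgroupOfEmb (κ.layerSubgroup n) (closureEmb (K := K) (v.adicCompletion K))) :=
    isCompact_iff_compactSpace.mp (isClosed_localLayer κ v n).isCompact
  obtain ⟨k, ℓ, hℓ⟩ := exists_torsToH1_eq _ hM c'
  refine ⟨n, k, ℓ, ?_, ?_⟩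
  · rw [mem_goodLevel_iff, hℓ, hc']; exact c.2
  · rw [hℓ, hc']

/-! ## The binder shapes of p784993 for `𝓛 := layerPairingOf …` -/

variable [SMulCommClass (absoluteGaloisGroup (v.adicCompletion K)) (padicCoeffIntegers S) M]
  (θ' : absoluteGaloisGroup K →ₜ* (padicCoeffIntegers S)ˣ) (P : Set (HeightOneSpectrum (𝓞 K)))
  (hstab : ∀ m : M, IsOpen (MulAction.stabilizer (absoluteGaloisGroup (v.adicCompletion K)) m : Set (absoluteGaloisGroup (v.adicCompletion K))))
  (Pk : ∀ k : ℕ, ContPairing (locCoeffRep S θ' P v k).toTopRep (torsRep M hstab p k).toTopRep (muAt K (p ^ k) v).toTopRep)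
  (hM : ∀ m : M, ∃ k : ℕ, p ^ k • m = 0) (γB : absoluteGaloisGroup K) (γv : absoluteGaloisGroup (v.adicCompletion K))
  (hγ : γB * resGalOfEmb (closureEmb (K := K) (v.adicCompletion K)) γv ∈ κ.kerSubgroup)
  (hNP : ∀ n, ramificationSubgroup K P ≤ κ.layerSubgroup n) (hv : AcSigned.IsNonsplitIn κ v)
  (hPred : ∀ (k : ℕ) (x : ↥(Representation.invariants ((muTwistO S θ' (k + 1)).toRepresentation.comp (ramificationSubgroup K P).subtype))) (m : ↥(torsionPow M p k)),
    (Pk (k + 1)).toLin x (AddSubgroup.inclusion (torsionPow_mono (M := M) (p := p) (Nat.le_succ k)) m) =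
      muInclusion K (pow_dvd_pow p (Nat.le_succ k)) ((Pk k).toLin (coeffMapO S P θ' (oMuRed S k) (oMuRed_muTwistO S θ' k) x) m))
  (hPsc : ∀ (k : ℕ) (a : padicCoeffIntegers S) (x : ↥(Representation.invariants ((muTwistO S θ' k).toRepresentation.comp (ramificationSubgroup K P).subtype)))
    (m : ↥(torsionPow M p k)), (Pk k).toLin (coeffMapO S P θ' (oMuScalar S (p ^ k) a) (oMuScalar_muTwistO S θ' k a) x) m = (Pk k).toLin x (a • m))

/-- `hgoodE` for `layerPairingOf` with `Good := goodLevel` (tautological). [cite: Kobayashi2003, Thm. 7.3 i)] -/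
theorem layerPairingOf_hgoodE (n k : ℕ) (ℓ : (layerPairingOf S κ θ' P v M hstab Pk hM γB γv hγ hNP hv hPred hPsc).L n k)
    (hℓ : ℓ ∈ goodLevel S κ v M V j ε n k) :
    resOfLe M (localSubgroupOfEmb_kerSubgroup_le κ v n) ((layerPairingOf S κ θ' P v M hstab Pk hM γB γv hγ hNP hv hPred hPsc).toH1 n k ℓ) ∈
      localCondInftySat κ M (padicCoeffIntegers S) V j ε v :=
  hℓ

/-- `hgood_mono` for `layerPairingOf` with `Good := goodLevel`. [cite: NeukirchSchmidtWingberg2008, I §5] -/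
theorem layerPairingOf_hgood_mono {n n' : ℕ} (hn : n ≤ n') {k k' : ℕ} (hk : k ≤ k') (ℓ : (layerPairingOf S κ θ' P v M hstab Pk hM γB γv hγ hNP hv hPred hPsc).L n k)
    (hℓ : ℓ ∈ goodLevel S κ v M V j ε n k) :
    (layerPairingOf S κ θ' P v M hstab Pk hM γB γv hγ hNP hv hPred hPsc).inclLE n' hk
        ((layerPairingOf S κ θ' P v M hstab Pk hM γB γv hγ hNP hv hPred hPsc).resLE hn k ℓ) ∈ goodLevel S κ v M V j ε n' k' :=
  goodLevel_mono S κ v M V j ε hn hk ℓ hℓ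

/-- `hgood` for `layerPairingOf` with `Good := goodLevel`. [cite: SerreGaloisCohomology1997, I §2.2 Prop. 8] [cite: Rubin2000, App. B.2] -/
theorem layerPairingOf_hgood (c : localCondInftySat κ M (padicCoeffIntegers S) V j ε v) :
    ∃ (n k : ℕ) (ℓ : (layerPairingOf S κ θ' P v M hstab Pk hM γB γv hγ hNP hv hPred hPsc).L n k), ℓ ∈ goodLevel S κ v M V j ε n k ∧
      resOfLe M (localSubgroupOfEmb_kerSubgroup_le κ v n) ((layerPairingOf S κ θ' P v M hstab Pk hM γB γv hγ hNP hv hPred hPsc).toH1 n k ℓ) = c :=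
  exists_mem_goodLevel S κ v M V j ε hstab hM c

end Good

end Summit.BirchSwinnertonDyer.BirchSwinnertonDyer.Theorems.SmallImageRttD2Seq

end
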